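import Literature.NumberTheory.Sieve.PolymathBoundedGapsAssembly
import Literature.NumberTheory.Sieve.PolymathBoundedGapsCert
import HarnessLib

/-!
# Polymath 8b, Theorem 1.4(i) (`liminf (p_{n+1} − p_n) ≤ 246`) proved: `frequently_nth_prime_succ_le_add_polymath_holds`

Topic `Literature/NumberTheory/Sieve`; sibling proof file (one theorem, no new definitions) of
`ParityWave0.lean` for the Wave-0 named fact
`Literature.NumberTheory.Sieve.frequently_nth_prime_succ_le_add_polymath` (**parity.S13**):
D. H. J. Polymath, *Variants of the Selberg sieve, and bounded intervals containing many primes*,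
Res. Math. Sci. 1:12 (2014) = arXiv:1407.4897, **Theorem 1.4(i)**: unconditionally `H₁ ≤ 246`,
i.e. `liminf_n (p_{n+1} − p_n) ≤ 246` — vendored as `∃ᶠ n, p_{n+1} ≤ p_n + 246` (equivalent for
integer gaps).

The tree already contains the whole printed deduction (arXiv p. 11: "`DHL[50,2]` is a consequence of
Theorem 3.12(i), the Bombieri–Vinogradov theorem and Theorem 3.13(i)"; p. 8: `DHL[k, m+1]` and an
admissible `k`-tuple of diameter `H(k)` give `H_m ≤ H(k)`, with `H(50) = 246`, Theorem 3.3(i)); this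
file only joins its two leaves, which live in modules neither of which imports the other:

* `PolymathBoundedGapsAssembly.lean`:
  `frequently_nth_prime_succ_le_add_polymath_of_fifty : exists_polymathFunctional_fifty_gt → parity.S13(246)`
  — Theorem 1.4(i) from Theorem 3.13(i), with Bombieri–Vinogradov
  (`bombieri_vinogradov_of_siegelWalfisz LFunctions.siegel_walfisz_holds`), Theorem 3.12(i)
  (`weakDHL_of_polymathFunctional_gt_holds`, `PolymathThetaSumsProofs.lean`) and the admissible
  50-tuple of diameter 246 (`narrowTuple50`, `PolymathBoundedGaps.lean`) all proved in the tree;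
* `PolymathBoundedGapsCert.lean`: `exists_polymathFunctional_fifty_gt_holds` — Theorem 3.13(i)
  (`M_{50,1/25} > 4.0043`), a kernel-evaluated exact certificate (`native_decide`; this is the one
  computational leaf, so the axiom closure of the theorem below contains `Lean.ofReduceBool` in
  addition to the three standard axioms, exactly as that of `exists_polymathFunctional_fifty_gt_holds`).

No named fact remains on this path.

## References

* D. H. J. Polymath, *Variants of the Selberg sieve, and bounded intervals containing many primes*,
  Res. Math. Sci. 1 (2014), Art. 12, doi:10.1186/s40687-014-0012-7 = arXiv:1407.4897, Theorem 1.4(i)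
  and its deduction from Theorems 2.3, 3.2(i), 3.3(i), 3.12(i), 3.13(i) (pp. 8, 11). [Polymath8b2014]
-/

namespace Literature.NumberTheory.Sieve

/-- **Polymath 8b, Theorem 1.4(i), PROVED**: `liminf_n (p_{n+1} − p_n) ≤ 246`, i.e. the Wave-0 named
fact `frequently_nth_prime_succ_le_add_polymath` (`∃ᶠ n, p_{n+1} ≤ p_n + 246`) DISCHARGED along the
printed deduction (pp. 8, 11): Theorem 3.13(i) (`exists_polymathFunctional_fifty_gt_holds`, the exact
`k = 50`, `ε = 1/25` certificate) fed into `frequently_nth_prime_succ_le_add_polymath_of_fifty`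
(Bombieri–Vinogradov via Siegel–Walfisz, Theorem 3.12(i), `DHL[50,2]`, and the admissible 50-tuple of
diameter 246). Computational leaf: `native_decide` inside Theorem 3.13(i).
[cite: Polymath8b2014, Theorem 1.4(i) and its deduction on pp. 8 and 11] -/
theorem frequently_nth_prime_succ_le_add_polymath_holds : frequently_nth_prime_succ_le_add_polymath :=
  frequently_nth_prime_succ_le_add_polymath_of_fifty exists_polymathFunctional_fifty_gt_holds

end Literature.NumberTheory.Sieve
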